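import Summits.ResolutionOfSingularities.ResolutionOfSingularities.Theorems.FrobeniusLadderFInjectiveMacaulayficationFInjectiveMacaulayficationDimFourSlice
import Summits.ResolutionOfSingularities.ResolutionOfSingularities.Theorems.FrobeniusLadderFInjectiveMacaulayficationClosedPointLocalResolutionAdmTr
import Summits.ResolutionOfSingularities.ResolutionOfSingularities.Theorems.FrobeniusLadderFInjectiveMacaulayficationLocalMacaulayficationOfFact
import HarnessLib

/-!
# THE DIM-`d` SLICE OF THE CRUX — the per-dimension PRICE TAG as one kernel theorem: on schemes of dimension `≤ d`,
# `FInjectiveMacaulayfication` ⟸ {CP 2019 Thm 1.1, R–G 081R, CP 2019 Prop 4.4} ∧ [Česnavičius 2021 Thm 5.3 as a binder] ∧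
# CLOSED-POINT admissible local resolution at levels `4 … d − 1` ∧ the F-half at levels `4 … d`
# (crux `FInjectiveMacaulayfication` stmt-ResolutionOfSingularities-15315, chain w45a; res-L1-w45a-plan-1 03:07:37Z «return to the (LR_adm) rung»;
# this seat's TAKING 03:22Z; seat res-L1-w45a-stub-3 g8)

[OURS · L1 W4.5a] Support file (`--supports stmt-ResolutionOfSingularities-15315 --as helper`); replaces the role of NO printed item; NOT a statement of any
manuscript; def-free. CONDITIONAL on the three printed theorems of the threefold package BY NAME, on ONE printed theorem as the spelled-out `Prop`-binder
`hM` (Česnavičius 2021 Thm 5.3 in blow-up form, verbatim as in `FInjectiveMacaulayficationDimFourSlice` / `OfLocalDoorAdm` §3), on this seat's CANDIDATE rung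
`ClosedPointLocalResolutionAdmTr.ClosedPointLocalResolutionAdmTr p e r` at the levels `4 ≤ e ≤ d − 1` and `r ≥ 1` ONLY (closed points of `e`-folds over
`k(X₁,…,X_r)`, never over a perfect field; the all-fields rung `ClosedPointLocalResolutionAdm p e` of p598957 a fortiori), and on the chain's CANDIDATE F-half
(`LocalFullificationFibreAdmGe4Split.LocalFInjectivizationFibreAdmGe4`'s body) at the levels `4 ≤ n ≤ d` ONLY. AI-written (weaker than expert review).

WHY: door v36.2's resolution-side stub (LR_adm) is d-UNIFORM; with `NonClosedPointChart` / `ClosedPointLocalResolutionAdm` (p598513 / p598957) a NON-closed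
point of a `d`-fold is a CLOSED point one level down, so on schemes of dimension `≤ d` the crux consumes exactly: closed-point admissible local RESOLUTION at
levels `4 … d − 1` (over finitely generated, imperfect fields) + the F-half (closed-point admissible local FULL-ification) at levels `≤ d` + print. `d = 4`
is `FInjectiveMacaulayficationDimFourSlice.fInjectiveMacaulayfication_dimLe4_of_fact_of_F4` (no resolution rung); `d = 5` reads «crux on schemes of
dimension ≤ 5 ⟸ CP-package ∧ [Česnavičius] ∧ `ClosedPointLocalResolutionAdmTr p 4 r` (`r ≥ 1`) ∧ F-half(4), F-half(5)».

* §1 `hlocAdm_of_cp_of_rungs` — THEOREM A-adm's hypothesis for ONE `X` of dimension `n`: Cossart–Piltant below local dimension 4, the rungs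
  `ClosedPointLocalResolutionAdmTr p e r`, `4 ≤ e ≤ n − 1`, `r ≥ 1`, at the non-closed points of local dimension `≥ 4` (`localBody_at_nonClosed_of_tr_lt`);
  `regularOffFinite_of_rungs` — regular off finitely many closed points.
* §2 `exists_isBlowup_full_of_fact_of_rungs_of_F (hn : topologicalKrullDim X = n) (h4 : 4 ≤ n)` — a blow-up model FULL at every point (F-Temkin at the
  closed singular points with the pointwise CM/F split `FInjectiveMacaulayficationDimFourSlice.exists_fullCentre_of_cmHalf_of_fHalf_at` at level `n`).
* §3 ★ **`fInjectiveMacaulayfication_dimLe_of_fact_of_rungs_of_F (d) (hG h081R hP) (hM) (hR) (hF) : «the route decl's ∀-text + one binder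
  topologicalKrullDim X ≤ d»`**, `…_of_LFadmF` (the same with the registered F-half def in full) and `…_of_admRungs_of_LFadmF` (with the all-fields rung).

[folklore assembly; cite: Temkin2008, Prop. 2.3.4; CossartPiltant2019, Thm. 1.1 (i)(ii) and Prop. 4.4; Cesnavicius2021, Thm. 5.3; EGAIV2, §5–§6]
-/

-- single-problem summit: the doubled namespace component is forced
set_option linter.dupNamespace false

noncomputable section

namespace Summit.ResolutionOfSingularities.ResolutionOfSingularities.Theorems.FInjectiveMacaulayfication.DimSlice

open CategoryTheory CategoryTheory.Limits AlgebraicGeometry TopologicalSpace IsLocalRing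
open Literature.AlgebraicGeometry.Resolution
open Summit.ResolutionOfSingularities.ResolutionOfSingularities.Theorems.FInjectiveMacaulayfication
open SliceableCentre ClosedPointLocalResolutionAdm ClosedPointLocalResolutionAdmTr

/-! ## §1 THEOREM A-adm for one variety of dimension `n`, from CP below 4 and the closed-point rungs `4 … n − 1` -/

/-- **(hloc) of `desingularization_offClosedPoints_of_local_adm` for ONE `X` of dimension `n ≥ 3`** from Cossart–Piltant below local dimension 4 and the
rungs `ClosedPointLocalResolutionAdmTr p e r`, `4 ≤ e ≤ n − 1`, `r ≥ 1`. [OURS · conditional-result] [cite: CossartPiltant2019, Thm. 1.1 (i)(ii); Prop. 4.4] -/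
theorem hlocAdm_of_cp_of_rungs
    (hG : CossartPiltant2019General.{0}) (h081R : Stacks081R.{0}) (hP : CossartPiltant2019Principalization.{0})
    (p : ℕ) (k : Type) [Field k] [CharP k p] (X : Scheme.{0}) (f₀ : X ⟶ Spec (.of k))
    [IsSeparated f₀] [LocallyOfFiniteType f₀] [QuasiCompact f₀] [IsIntegral X] {n : ℕ} (hn : topologicalKrullDim X = n) (h3 : 3 ≤ n)
    (hR : ∀ e r : ℕ, 4 ≤ e → e + 1 ≤ n → 1 ≤ r → ClosedPointLocalResolutionAdmTr p e r) :
    ∀ ζ : X, ¬ IsClosed ({ζ} : Set X) →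
      (∀ (S' : Scheme.{0}) (g : S' ⟶ Spec (X.presheaf.stalk ζ)) (I : (Spec (X.presheaf.stalk ζ)).IdealSheafData),
        IsBlowup g I → ((I.support : Set _) ⊆ (Scheme.regularLocus (Spec (X.presheaf.stalk ζ)))ᶜ) →
          (∀ s : S', s ∉ Scheme.regularLocus S' → g.base s = closedPoint (X.presheaf.stalk ζ)) →
          Scheme.AdmitsDesingularization S') ∨
      (∃ x : X, ζ ⤳ x ∧ ∀ (S' : Scheme.{0}) (g : S' ⟶ Spec (X.presheaf.stalk x)) (I : (Spec (X.presheaf.stalk x)).IdealSheafData),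
        IsBlowup g I → ((I.support : Set _) ⊆ (Scheme.regularLocus (Spec (X.presheaf.stalk x)))ᶜ) →
          Scheme.AdmitsDesingularization S') := by
  intro ζ hζ
  haveI : IsLocallyNoetherian X := LocallyOfFiniteType.isLocallyNoetherian f₀
  obtain ⟨m, hm⟩ := exists_nat_cast_eq_ringKrullDim (R := X.presheaf.stalk ζ)
  by_cases hm3 : m ≤ 3
  · -- below local dimension 4: specialise to a loc-dim-3 point, Cossart–Piltant there (no fibre condition needed)
    obtain ⟨x, hζx, hx3⟩ := RegularOffCodimFourResidue.exists_specializes_ringKrullDim_stalk_eq f₀ hn ζ (n := 3)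
      (by rw [hm]; exact_mod_cast hm3) h3
    exact Or.inr ⟨x, hζx, fun S' g I hg _ => LocalBlowupDesingularizationDimThree.localBlowups_hloc hG h081R hP f₀ x hx3 S' g I hg⟩
  · -- local dimension ≥ 4: the closed-point rung at level `m ≤ n − 1`
    refine Or.inl (localBody_at_nonClosed_of_tr_lt p f₀ hn hR ζ hζ ?_)
    rw [hm]
    exact_mod_cast (by omega : 4 ≤ m)

/-- **REGULAR OFF FINITELY MANY CLOSED POINTS, for one `X` of dimension `n ≥ 3`, modulo the rungs `4 … n − 1` and the threefold package.**
[OURS · conditional-result] [cite: Temkin2008, Prop. 2.3.4] [cite: CossartPiltant2019, Thm. 1.1 (i)(ii); Prop. 4.4] -/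
theorem regularOffFinite_of_rungs
    (hG : CossartPiltant2019General.{0}) (h081R : Stacks081R.{0}) (hP : CossartPiltant2019Principalization.{0})
    (p : ℕ) (k : Type) [Field k] [CharP k p] (X : Scheme.{0}) (f₀ : X ⟶ Spec (.of k))
    [IsSeparated f₀] [LocallyOfFiniteType f₀] [QuasiCompact f₀] [IsIntegral X] {n : ℕ} (hn : topologicalKrullDim X = n) (h3 : 3 ≤ n)
    (hR : ∀ e r : ℕ, 4 ≤ e → e + 1 ≤ n → 1 ≤ r → ClosedPointLocalResolutionAdmTr p e r) :
    ∃ (X' : Scheme.{0}) (f : X' ⟶ X) (J : X.IdealSheafData) (F : Set X), IsBlowup f J ∧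
      (J.support : Set X) ⊆ (Scheme.regularLocus X)ᶜ ∧ IsClosed F ∧ F.Finite ∧ (∀ b ∈ F, IsClosed ({b} : Set X)) ∧
      ∀ x' : X', f x' ∉ F → x' ∈ Scheme.regularLocus X' := by
  have hk : Scheme.IsQuasiExcellent (Spec (.of k)) :=
    Scheme.isQuasiExcellent_of_locallyOfFiniteType Stacks07QW_field_holds (𝟙 (Spec (.of k)))
  haveI : IsNoetherianRing (CommRingCat.of k) := inferInstanceAs (IsNoetherianRing k)
  exact DesingularizationOffClosedPointsAdm.desingularization_offFinite_of_local_adm hk f₀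
    (hlocAdm_of_cp_of_rungs hG h081R hP p k X f₀ hn h3 hR)

/-! ## §2 A FULL blow-up model of an `n`-fold, `n ≥ 4`, from the rungs, the fact and the F-half at level `n` -/

/-- **A FULL blow-up model of every integral separated finite-type `n`-FOLD, `n ≥ 4`**, modulo {CP 1.1, 081R, CP 4.4} ∧ [Česnavičius 5.3 as typed] ∧
the closed-point rungs `4 … n − 1` ∧ the F-half AT LEVEL `n`. §1 supplies a model regular off finitely many closed points; the dimension-free F-Temkin engine
(`FTemkinClosedPointsAdm.full_model_of_regularOffFinite_of_localAdm`) finishes at the closed singular points with the pointwise CM/F split.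
[OURS · conditional-result] [cite: Temkin2008, Prop. 2.3.4] [cite: CossartPiltant2019, Thm. 1.1; Prop. 4.4] [cite: Cesnavicius2021, Thm. 5.3] -/
theorem exists_isBlowup_full_of_fact_of_rungs_of_F
    (hG : CossartPiltant2019General.{0}) (h081R : Stacks081R.{0}) (hP : CossartPiltant2019Principalization.{0})
    (hM : ∀ (Y : Scheme.{0}) [IsIntegral Y] [IsNoetherian Y], Scheme.IsExcellent Y →
      ∃ Z : Y.IdealSheafData,
        (∀ y : Y, y ∈ (Z.support : Set Y) →
          ¬ (∀ d : ℕ, ringKrullDim (Y.presheaf.stalk y) = d →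
              ∀ s : Fin d → Y.presheaf.stalk y, (Ideal.span (Set.range s)).radical.IsMaximal →
                RingTheory.Sequence.IsWeaklyRegular (Y.presheaf.stalk y) (List.ofFn s))) ∧
        ∀ (Y' : Scheme.{0}) (π : Y' ⟶ Y), IsBlowup π Z →
          ∀ y' : Y', ∀ d : ℕ, ringKrullDim (Y'.presheaf.stalk y') = d →
            ∀ s : Fin d → Y'.presheaf.stalk y', (Ideal.span (Set.range s)).radical.IsMaximal →
              RingTheory.Sequence.IsWeaklyRegular (Y'.presheaf.stalk y') (List.ofFn s))
    {n : ℕ} (h4 : 4 ≤ n) (p : ℕ) (hp : p.Prime)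
    (hR : ∀ e r : ℕ, 4 ≤ e → e + 1 ≤ n → 1 ≤ r → ClosedPointLocalResolutionAdmTr p e r)
    (hFn : ∀ (k : Type) [Field k] [CharP k p]
    (X : Scheme.{0}) (f : X ⟶ Spec (.of k)),
      IsSeparated f → LocallyOfFiniteType f → QuasiCompact f → IsIntegral X →
      ∀ x : X, IsClosed ({x} : Set X) → x ∉ Scheme.regularLocus X → ringKrullDim (X.presheaf.stalk x) = n →
      ∀ (S' : Scheme.{0}) (g : S' ⟶ Spec (X.presheaf.stalk x)) (I : (Spec (X.presheaf.stalk x)).IdealSheafData),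
        I ≠ ⊥ → (I.support : Set (Spec (X.presheaf.stalk x))) ⊆ (Scheme.regularLocus (Spec (X.presheaf.stalk x)))ᶜ → IsBlowup g I →
        (∀ s : S', g.base s ≠ closedPoint (X.presheaf.stalk x) → s ∈ Scheme.regularLocus S') →
        (∀ s : S', CMCl (S'.presheaf.stalk s)) →
        ∃ 𝓚 : S'.IdealSheafData, 𝓚 ≠ ⊥ ∧ (∀ s ∈ (𝓚.support : Set S'), g.base s = closedPoint (X.presheaf.stalk x)) ∧
          ∀ (S'' : Scheme.{0}) (π : S'' ⟶ S'), IsBlowup π 𝓚 →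
            ∀ s : S'', FullCl p (S''.presheaf.stalk s))
    (k : Type) [Field k] [CharP k p] (X : Scheme.{0}) (f₀ : X ⟶ Spec (.of k))
    [IsSeparated f₀] [LocallyOfFiniteType f₀] [QuasiCompact f₀] [IsIntegral X] (hn : topologicalKrullDim X = n) :
    ∃ (X'' : Scheme.{0}) (f'' : X'' ⟶ X) (J'' : X.IdealSheafData), IsBlowup f'' J'' ∧ J'' ≠ ⊥ ∧
      (J''.support : Set X) ⊆ (Scheme.regularLocus X)ᶜ ∧ ∀ x'' : X'', FullCl p (X''.presheaf.stalk x'') := by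
  classical
  obtain ⟨X', f, J, F, hf, hJ, -, hF, hFcl, hreg⟩ := regularOffFinite_of_rungs hG h081R hP p k X f₀ hn (by omega) hR
  refine FTemkinClosedPointsAdm.full_model_of_regularOffFinite_of_localAdm p hp k X f₀ ?_ X' f J hf hJ hF.toFinset
    (fun b hb => hFcl b (hF.mem_toFinset.mp hb)) (fun x' hx' => (Scheme.mem_regularLocus _).mp (hreg x' fun h => hx' (hF.mem_toFinset.mpr h)))
  intro b hbcl hbs S' g I hI hIadm hg hregS
  have hbn : ringKrullDim (X.presheaf.stalk b) = n := FTemkinClosedPoints.ringKrullDim_stalk_eq_of_isClosed f₀ hn b hbcl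
  exact FInjectiveMacaulayficationDimFourSlice.exists_fullCentre_of_cmHalf_of_fHalf_at p f₀ b hbs
    (fun S' g I hI hg hregS => LocalMacaulayficationOfFact.exists_cmCentre_of_fact hM p hp f₀ b S' g I hI hg hregS)
    (fun S' g I hI hIadm hg hregS hcm =>
      hFn k X f₀ inferInstance inferInstance inferInstance inferInstance b hbcl hbs hbn S' g I hI hIadm hg hregS hcm)
    S' g I hI hIadm hg hregS

/-! ## §3 The dim ≤ d slice of the crux -/

/-- **Integral form, dimension ≤ d**: a proper birational integral model FULL at every point (dimension ≤ 3: Cossart–Piltant outright; dimension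
`n ∈ [4, d]`: §2 with the rungs `4 … n − 1` and the F-half at level `n`). [OURS · conditional-result]
[cite: CossartPiltant2019, Thm. 1.1; Prop. 4.4] [cite: Temkin2008, Prop. 2.3.4] [cite: Cesnavicius2021, Thm. 5.3] -/
theorem fiModel_integral_dimLe_of_fact_of_rungs_of_F (d : ℕ)
    (hG : CossartPiltant2019General.{0}) (h081R : Stacks081R.{0}) (hP : CossartPiltant2019Principalization.{0})
    (hM : ∀ (Y : Scheme.{0}) [IsIntegral Y] [IsNoetherian Y], Scheme.IsExcellent Y →
      ∃ Z : Y.IdealSheafData,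
        (∀ y : Y, y ∈ (Z.support : Set Y) →
          ¬ (∀ d : ℕ, ringKrullDim (Y.presheaf.stalk y) = d →
              ∀ s : Fin d → Y.presheaf.stalk y, (Ideal.span (Set.range s)).radical.IsMaximal →
                RingTheory.Sequence.IsWeaklyRegular (Y.presheaf.stalk y) (List.ofFn s))) ∧
        ∀ (Y' : Scheme.{0}) (π : Y' ⟶ Y), IsBlowup π Z →
          ∀ y' : Y', ∀ d : ℕ, ringKrullDim (Y'.presheaf.stalk y') = d →
            ∀ s : Fin d → Y'.presheaf.stalk y', (Ideal.span (Set.range s)).radical.IsMaximal →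
              RingTheory.Sequence.IsWeaklyRegular (Y'.presheaf.stalk y') (List.ofFn s))
    (p : ℕ) [hp : Fact p.Prime]
    (hR : ∀ e r : ℕ, 4 ≤ e → e + 1 ≤ d → 1 ≤ r → ClosedPointLocalResolutionAdmTr p e r)
    (hF : ∀ n : ℕ, 4 ≤ n → n ≤ d → ∀ (k : Type) [Field k] [CharP k p]
    (X : Scheme.{0}) (f : X ⟶ Spec (.of k)),
      IsSeparated f → LocallyOfFiniteType f → QuasiCompact f → IsIntegral X →
      ∀ x : X, IsClosed ({x} : Set X) → x ∉ Scheme.regularLocus X → ringKrullDim (X.presheaf.stalk x) = n →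
      ∀ (S' : Scheme.{0}) (g : S' ⟶ Spec (X.presheaf.stalk x)) (I : (Spec (X.presheaf.stalk x)).IdealSheafData),
        I ≠ ⊥ → (I.support : Set (Spec (X.presheaf.stalk x))) ⊆ (Scheme.regularLocus (Spec (X.presheaf.stalk x)))ᶜ → IsBlowup g I →
        (∀ s : S', g.base s ≠ closedPoint (X.presheaf.stalk x) → s ∈ Scheme.regularLocus S') →
        (∀ s : S', CMCl (S'.presheaf.stalk s)) →
        ∃ 𝓚 : S'.IdealSheafData, 𝓚 ≠ ⊥ ∧ (∀ s ∈ (𝓚.support : Set S'), g.base s = closedPoint (X.presheaf.stalk x)) ∧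
          ∀ (S'' : Scheme.{0}) (π : S'' ⟶ S'), IsBlowup π 𝓚 →
            ∀ s : S'', FullCl p (S''.presheaf.stalk s))
    (k : Type) [Field k] [CharP k p] (X : Scheme.{0}) (f : X ⟶ Spec (.of k))
    [IsSeparated f] [LocallyOfFiniteType f] [QuasiCompact f] [IsIntegral X] (hXd : topologicalKrullDim X ≤ d) :
    ∃ (X' : Scheme.{0}) (π : X' ⟶ X), IsProper π ∧ IsBirational π ∧ IsIntegral X' ∧ ∀ x : X', FullCl p (X'.presheaf.stalk x) := by
  by_cases h3 : topologicalKrullDim X ≤ 3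
  · exact FInjectiveMacaulayficationDimFour.fiModel_integral_of_dim_le_three hG p k X f h3
  · -- `dim X = n` with `4 ≤ n ≤ d`
    obtain ⟨n, h4n, hnd, hn⟩ : ∃ n : ℕ, 4 ≤ n ∧ n ≤ d ∧ topologicalKrullDim X = n := by
      have h := hXd
      induction hD : topologicalKrullDim X using WithBot.recBotCoe with
      | bot => rw [hD] at h3; exact absurd bot_le h3
      | coe a =>
        rw [hD] at h h3
        induction a using ENat.recTopCoe with
        | top => exact absurd (WithBot.coe_le_coe.mp h) (by simp)
        | coe m =>
          have hm : m ≤ d := by exact_mod_cast (WithBot.coe_le_coe.mp h)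
          have hm' : ¬ m ≤ 3 := fun hle =>
            h3 (WithBot.coe_le_coe.mpr (by exact_mod_cast hle : (m : ℕ∞) ≤ (3 : ℕ∞)))
          exact ⟨m, by omega, hm, rfl⟩
    haveI : IsLocallyNoetherian X := LocallyOfFiniteType.isLocallyNoetherian f
    obtain ⟨X'', f'', J'', hf'', hJ'', -, hfull⟩ := exists_isBlowup_full_of_fact_of_rungs_of_F hG h081R hP hM h4n p hp.out
      (fun e r he hen hr => hR e r he (by omega) hr) (hF n h4n hnd) k X f hn
    haveI : IsIntegral X'' := hf''.isIntegral hJ''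
    exact ⟨X'', f'', hf''.isProper, hf''.isBirational' hJ'', inferInstance, hfull⟩

/-- **The crux's conclusion for a given reduced `X` of dimension ≤ d** (component gluing as in `DimLe4Reduced`). [OURS · conditional-result]
[cite: CossartPiltant2019, Thm. 1.1; Prop. 4.4; proof of Prop. 4.6 Step 1] [cite: Cesnavicius2021, Thm. 5.3] -/
theorem exists_fiModel_dimLe_of_fact_of_rungs_of_F (d : ℕ)
    (hG : CossartPiltant2019General.{0}) (h081R : Stacks081R.{0}) (hP : CossartPiltant2019Principalization.{0})
    (hM : ∀ (Y : Scheme.{0}) [IsIntegral Y] [IsNoetherian Y], Scheme.IsExcellent Y →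
      ∃ Z : Y.IdealSheafData,
        (∀ y : Y, y ∈ (Z.support : Set Y) →
          ¬ (∀ d : ℕ, ringKrullDim (Y.presheaf.stalk y) = d →
              ∀ s : Fin d → Y.presheaf.stalk y, (Ideal.span (Set.range s)).radical.IsMaximal →
                RingTheory.Sequence.IsWeaklyRegular (Y.presheaf.stalk y) (List.ofFn s))) ∧
        ∀ (Y' : Scheme.{0}) (π : Y' ⟶ Y), IsBlowup π Z →
          ∀ y' : Y', ∀ d : ℕ, ringKrullDim (Y'.presheaf.stalk y') = d →
            ∀ s : Fin d → Y'.presheaf.stalk y', (Ideal.span (Set.range s)).radical.IsMaximal →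
              RingTheory.Sequence.IsWeaklyRegular (Y'.presheaf.stalk y') (List.ofFn s))
    (p : ℕ) [Fact p.Prime]
    (hR : ∀ e r : ℕ, 4 ≤ e → e + 1 ≤ d → 1 ≤ r → ClosedPointLocalResolutionAdmTr p e r)
    (hF : ∀ n : ℕ, 4 ≤ n → n ≤ d → ∀ (k : Type) [Field k] [CharP k p]
    (X : Scheme.{0}) (f : X ⟶ Spec (.of k)),
      IsSeparated f → LocallyOfFiniteType f → QuasiCompact f → IsIntegral X →
      ∀ x : X, IsClosed ({x} : Set X) → x ∉ Scheme.regularLocus X → ringKrullDim (X.presheaf.stalk x) = n →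
      ∀ (S' : Scheme.{0}) (g : S' ⟶ Spec (X.presheaf.stalk x)) (I : (Spec (X.presheaf.stalk x)).IdealSheafData),
        I ≠ ⊥ → (I.support : Set (Spec (X.presheaf.stalk x))) ⊆ (Scheme.regularLocus (Spec (X.presheaf.stalk x)))ᶜ → IsBlowup g I →
        (∀ s : S', g.base s ≠ closedPoint (X.presheaf.stalk x) → s ∈ Scheme.regularLocus S') →
        (∀ s : S', CMCl (S'.presheaf.stalk s)) →
        ∃ 𝓚 : S'.IdealSheafData, 𝓚 ≠ ⊥ ∧ (∀ s ∈ (𝓚.support : Set S'), g.base s = closedPoint (X.presheaf.stalk x)) ∧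
          ∀ (S'' : Scheme.{0}) (π : S'' ⟶ S'), IsBlowup π 𝓚 →
            ∀ s : S'', FullCl p (S''.presheaf.stalk s))
    (k : Type) [Field k] [CharP k p] (X : Scheme.{0}) (f : X ⟶ Spec (.of k))
    [IsSeparated f] [LocallyOfFiniteType f] [QuasiCompact f] [IsReduced X] (hXd : topologicalKrullDim X ≤ d) :
    ∃ (X' : Scheme.{0}) (π : X' ⟶ X), IsProper π ∧ IsBirational π ∧ ∀ x : X',
      IsDomain (X'.presheaf.stalk x) ∧ ∀ d : ℕ, ringKrullDim (X'.presheaf.stalk x) = d →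
        ∀ s : Fin d → X'.presheaf.stalk x, (Ideal.span (Set.range s)).radical.IsMaximal →
          RingTheory.Sequence.IsWeaklyRegular (X'.presheaf.stalk x) (List.ofFn s) ∧
          ∀ y : X'.presheaf.stalk x, (∃ e : ℕ, y ^ p ^ e ∈ Ideal.span
            ((fun z : X'.presheaf.stalk x => z ^ p ^ e) ''
              (Ideal.span (Set.range s) : Set (X'.presheaf.stalk x)))) →
            y ∈ Ideal.span (Set.range s) := by
  refine exists_model_of_forall_closeds
    (fun Y : Scheme.{0} => ∀ y : Y, IsDomain (Y.presheaf.stalk y) ∧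
      ∀ d : ℕ, ringKrullDim (Y.presheaf.stalk y) = d →
        ∀ s : Fin d → Y.presheaf.stalk y, (Ideal.span (Set.range s)).radical.IsMaximal →
          RingTheory.Sequence.IsWeaklyRegular (Y.presheaf.stalk y) (List.ofFn s) ∧
          ∀ w : Y.presheaf.stalk y, (∃ e : ℕ, w ^ p ^ e ∈ Ideal.span
            ((fun z : Y.presheaf.stalk y => z ^ p ^ e) ''
              (Ideal.span (Set.range s) : Set (Y.presheaf.stalk y)))) →
            w ∈ Ideal.span (Set.range s))
    (fun Y hY y => (hY.false y).elim) (fun U V hU hV => fiClause_coprod p hU hV) X f fun Z hZ => ?_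
  haveI := hZ
  have hdimZ : topologicalKrullDim (Scheme.IdealSheafData.vanishingIdeal Z).subscheme ≤ d :=
    (DimLe4Reduced.topologicalKrullDim_subscheme_vanishingIdeal_le Z).trans hXd
  obtain ⟨X', π, hprop, hbir, -, hfi⟩ :=
    fiModel_integral_dimLe_of_fact_of_rungs_of_F d hG h081R hP hM p hR hF k _ ((Scheme.IdealSheafData.vanishingIdeal Z).subschemeι ≫ f) hdimZ
  exact ⟨X', π, hprop, hbir, hfi⟩

/-- **★ THE DIM ≤ d SLICE OF THE CRUX ⟸ {CP 1.1, R–G 081R, CP 4.4, Česnavičius 5.3 (as typed)} ∧ RUNGS `4 … d − 1` ∧ F-HALF `4 … d`.** The ∀-text of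
`Theses.FrobeniusLadder.FInjectiveMacaulayfication` VERBATIM with the single extra binder `topologicalKrullDim X ≤ d`; the resolution rung
`ClosedPointLocalResolutionAdmTr p e r` enters ONLY at the levels `4 ≤ e ≤ d − 1`, `r ≥ 1` (closed points over `k(X₁,…,X_r)`, imperfect) and the F-half ONLY
at the levels `4 ≤ n ≤ d` — the per-dimension price tag.
[OURS · conditional-result] [cite: CossartPiltant2019, Thm. 1.1; Prop. 4.4] [cite: Temkin2008, Prop. 2.3.4] [cite: Cesnavicius2021, Thm. 5.3] -/
theorem fInjectiveMacaulayfication_dimLe_of_fact_of_rungs_of_F (d : ℕ)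
    (hG : CossartPiltant2019General.{0}) (h081R : Stacks081R.{0}) (hP : CossartPiltant2019Principalization.{0})
    (hM : ∀ (Y : Scheme.{0}) [IsIntegral Y] [IsNoetherian Y], Scheme.IsExcellent Y →
      ∃ Z : Y.IdealSheafData,
        (∀ y : Y, y ∈ (Z.support : Set Y) →
          ¬ (∀ d : ℕ, ringKrullDim (Y.presheaf.stalk y) = d →
              ∀ s : Fin d → Y.presheaf.stalk y, (Ideal.span (Set.range s)).radical.IsMaximal →
                RingTheory.Sequence.IsWeaklyRegular (Y.presheaf.stalk y) (List.ofFn s))) ∧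
        ∀ (Y' : Scheme.{0}) (π : Y' ⟶ Y), IsBlowup π Z →
          ∀ y' : Y', ∀ d : ℕ, ringKrullDim (Y'.presheaf.stalk y') = d →
            ∀ s : Fin d → Y'.presheaf.stalk y', (Ideal.span (Set.range s)).radical.IsMaximal →
              RingTheory.Sequence.IsWeaklyRegular (Y'.presheaf.stalk y') (List.ofFn s))
    (hR : ∀ p e r : ℕ, p.Prime → 4 ≤ e → e + 1 ≤ d → 1 ≤ r → ClosedPointLocalResolutionAdmTr p e r)
    (hF : ∀ n : ℕ, 4 ≤ n → n ≤ d → ∀ (p : ℕ), p.Prime → ∀ (k : Type) [Field k] [CharP k p]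
    (X : Scheme.{0}) (f : X ⟶ Spec (.of k)),
      IsSeparated f → LocallyOfFiniteType f → QuasiCompact f → IsIntegral X →
      ∀ x : X, IsClosed ({x} : Set X) → x ∉ Scheme.regularLocus X → ringKrullDim (X.presheaf.stalk x) = n →
      ∀ (S' : Scheme.{0}) (g : S' ⟶ Spec (X.presheaf.stalk x)) (I : (Spec (X.presheaf.stalk x)).IdealSheafData),
        I ≠ ⊥ → (I.support : Set (Spec (X.presheaf.stalk x))) ⊆ (Scheme.regularLocus (Spec (X.presheaf.stalk x)))ᶜ → IsBlowup g I →
        (∀ s : S', g.base s ≠ closedPoint (X.presheaf.stalk x) → s ∈ Scheme.regularLocus S') →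
        (∀ s : S', CMCl (S'.presheaf.stalk s)) →
        ∃ 𝓚 : S'.IdealSheafData, 𝓚 ≠ ⊥ ∧ (∀ s ∈ (𝓚.support : Set S'), g.base s = closedPoint (X.presheaf.stalk x)) ∧
          ∀ (S'' : Scheme.{0}) (π : S'' ⟶ S'), IsBlowup π 𝓚 →
            ∀ s : S'', FullCl p (S''.presheaf.stalk s)) :
    ∀ p : ℕ, p.Prime → ∀ (k : Type) [Field k] [CharP k p] (X : Scheme.{0}) (f : X ⟶ Spec (.of k)),
      IsSeparated f → LocallyOfFiniteType f → QuasiCompact f → IsReduced X → topologicalKrullDim X ≤ d →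
      ∃ (X' : Scheme.{0}) (π : X' ⟶ X), IsProper π ∧ IsBirational π ∧ ∀ x : X',
        IsDomain (X'.presheaf.stalk x) ∧ ∀ d : ℕ, ringKrullDim (X'.presheaf.stalk x) = d →
          ∀ s : Fin d → X'.presheaf.stalk x, (Ideal.span (Set.range s)).radical.IsMaximal →
            RingTheory.Sequence.IsWeaklyRegular (X'.presheaf.stalk x) (List.ofFn s) ∧
            ∀ y : X'.presheaf.stalk x, (∃ e : ℕ, y ^ p ^ e ∈ Ideal.span
              ((fun z : X'.presheaf.stalk x => z ^ p ^ e) ''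
                (Ideal.span (Set.range s) : Set (X'.presheaf.stalk x)))) →
              y ∈ Ideal.span (Set.range s) := by
  intro p hp k _ _ X f hsep hft hqc hred hXd
  haveI : Fact p.Prime := ⟨hp⟩
  haveI := hsep
  haveI := hft
  haveI := hqc
  haveI := hred
  exact exists_fiModel_dimLe_of_fact_of_rungs_of_F d hG h081R hP hM p (fun e r he hed hr => hR p e r hp he hed hr)
    (fun n hn hnd => hF n hn hnd p hp) k X f hXd

/-- **The same with the chain's registered F-half IN FULL** (`LocalFullificationFibreAdmGe4Split.LocalFInjectivizationFibreAdmGe4`, all levels) — for readers who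
hold the door's F-stub: on schemes of dimension `≤ d` the resolution-side input of door v36.2 is exactly the closed-point rungs `4 … d − 1`.
[OURS · conditional-result] [cite: CossartPiltant2019, Thm. 1.1; Prop. 4.4] [cite: Temkin2008, Prop. 2.3.4] [cite: Cesnavicius2021, Thm. 5.3] -/
theorem fInjectiveMacaulayfication_dimLe_of_fact_of_rungs_of_LFadmF (d : ℕ)
    (hG : CossartPiltant2019General.{0}) (h081R : Stacks081R.{0}) (hP : CossartPiltant2019Principalization.{0})
    (hM : ∀ (Y : Scheme.{0}) [IsIntegral Y] [IsNoetherian Y], Scheme.IsExcellent Y →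
      ∃ Z : Y.IdealSheafData,
        (∀ y : Y, y ∈ (Z.support : Set Y) →
          ¬ (∀ d : ℕ, ringKrullDim (Y.presheaf.stalk y) = d →
              ∀ s : Fin d → Y.presheaf.stalk y, (Ideal.span (Set.range s)).radical.IsMaximal →
                RingTheory.Sequence.IsWeaklyRegular (Y.presheaf.stalk y) (List.ofFn s))) ∧
        ∀ (Y' : Scheme.{0}) (π : Y' ⟶ Y), IsBlowup π Z →
          ∀ y' : Y', ∀ d : ℕ, ringKrullDim (Y'.presheaf.stalk y') = d →
            ∀ s : Fin d → Y'.presheaf.stalk y', (Ideal.span (Set.range s)).radical.IsMaximal →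
              RingTheory.Sequence.IsWeaklyRegular (Y'.presheaf.stalk y') (List.ofFn s))
    (hR : ∀ p e r : ℕ, p.Prime → 4 ≤ e → e + 1 ≤ d → 1 ≤ r → ClosedPointLocalResolutionAdmTr p e r)
    (hLF : LocalFullificationFibreAdmGe4Split.LocalFInjectivizationFibreAdmGe4) :
    ∀ p : ℕ, p.Prime → ∀ (k : Type) [Field k] [CharP k p] (X : Scheme.{0}) (f : X ⟶ Spec (.of k)),
      IsSeparated f → LocallyOfFiniteType f → QuasiCompact f → IsReduced X → topologicalKrullDim X ≤ d →
      ∃ (X' : Scheme.{0}) (π : X' ⟶ X), IsProper π ∧ IsBirational π ∧ ∀ x : X',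
        IsDomain (X'.presheaf.stalk x) ∧ ∀ d : ℕ, ringKrullDim (X'.presheaf.stalk x) = d →
          ∀ s : Fin d → X'.presheaf.stalk x, (Ideal.span (Set.range s)).radical.IsMaximal →
            RingTheory.Sequence.IsWeaklyRegular (X'.presheaf.stalk x) (List.ofFn s) ∧
            ∀ y : X'.presheaf.stalk x, (∃ e : ℕ, y ^ p ^ e ∈ Ideal.span
              ((fun z : X'.presheaf.stalk x => z ^ p ^ e) ''
                (Ideal.span (Set.range s) : Set (X'.presheaf.stalk x)))) →
              y ∈ Ideal.span (Set.range s) :=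
  fInjectiveMacaulayfication_dimLe_of_fact_of_rungs_of_F d hG h081R hP hM hR fun n hn _ => hLF n hn

/-- **The same with the ALL-FIELDS rung `ClosedPointLocalResolutionAdm p e`** (p598957; stronger hypothesis, through `closedPointLocalResolutionAdmTr_of_adm`)
and the registered F-half in full. [OURS · conditional-result] [cite: CossartPiltant2019, Thm. 1.1; Prop. 4.4] [cite: Temkin2008, Prop. 2.3.4] [cite: Cesnavicius2021, Thm. 5.3] -/
theorem fInjectiveMacaulayfication_dimLe_of_fact_of_admRungs_of_LFadmF (d : ℕ)
    (hG : CossartPiltant2019General.{0}) (h081R : Stacks081R.{0}) (hP : CossartPiltant2019Principalization.{0})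
    (hM : ∀ (Y : Scheme.{0}) [IsIntegral Y] [IsNoetherian Y], Scheme.IsExcellent Y →
      ∃ Z : Y.IdealSheafData,
        (∀ y : Y, y ∈ (Z.support : Set Y) →
          ¬ (∀ d : ℕ, ringKrullDim (Y.presheaf.stalk y) = d →
              ∀ s : Fin d → Y.presheaf.stalk y, (Ideal.span (Set.range s)).radical.IsMaximal →
                RingTheory.Sequence.IsWeaklyRegular (Y.presheaf.stalk y) (List.ofFn s))) ∧
        ∀ (Y' : Scheme.{0}) (π : Y' ⟶ Y), IsBlowup π Z →
          ∀ y' : Y', ∀ d : ℕ, ringKrullDim (Y'.presheaf.stalk y') = d →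
            ∀ s : Fin d → Y'.presheaf.stalk y', (Ideal.span (Set.range s)).radical.IsMaximal →
              RingTheory.Sequence.IsWeaklyRegular (Y'.presheaf.stalk y') (List.ofFn s))
    (hR : ∀ p e : ℕ, p.Prime → 4 ≤ e → e + 1 ≤ d → ClosedPointLocalResolutionAdm p e)
    (hLF : LocalFullificationFibreAdmGe4Split.LocalFInjectivizationFibreAdmGe4) :
    ∀ p : ℕ, p.Prime → ∀ (k : Type) [Field k] [CharP k p] (X : Scheme.{0}) (f : X ⟶ Spec (.of k)),
      IsSeparated f → LocallyOfFiniteType f → QuasiCompact f → IsReduced X → topologicalKrullDim X ≤ d →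
      ∃ (X' : Scheme.{0}) (π : X' ⟶ X), IsProper π ∧ IsBirational π ∧ ∀ x : X',
        IsDomain (X'.presheaf.stalk x) ∧ ∀ d : ℕ, ringKrullDim (X'.presheaf.stalk x) = d →
          ∀ s : Fin d → X'.presheaf.stalk x, (Ideal.span (Set.range s)).radical.IsMaximal →
            RingTheory.Sequence.IsWeaklyRegular (X'.presheaf.stalk x) (List.ofFn s) ∧
            ∀ y : X'.presheaf.stalk x, (∃ e : ℕ, y ^ p ^ e ∈ Ideal.span
              ((fun z : X'.presheaf.stalk x => z ^ p ^ e) ''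
                (Ideal.span (Set.range s) : Set (X'.presheaf.stalk x)))) →
              y ∈ Ideal.span (Set.range s) :=
  fInjectiveMacaulayfication_dimLe_of_fact_of_rungs_of_LFadmF d hG h081R hP hM
    (fun p e r hp he hed _ => closedPointLocalResolutionAdmTr_of_adm (hR p e hp he hed) r) hLF

end Summit.ResolutionOfSingularities.ResolutionOfSingularities.Theorems.FInjectiveMacaulayfication.DimSlice

end
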